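import Summits.Ventures.DiscreteObjects.PP12.Involution

/-!
# The quotient of a projective plane by an involutory elation has `λ ∈ {0, 2}` (family F-INV2, kernel core of the reduction)
Framing: lottery ticket; floor = certified bounds/negative ranges.

Family F-INV2 of the census cell `pub-namedobj` (target M; FAMILY-INV2.md, RULING M4) reduces "a projective plane of order 12 with
an involution" to "a symmetric transversal design STD₂[12;6] whose GF(2) lift system is consistent". The involution is an elation by
`elation_of_sq` (p222353). This file kernel-checks the COMBINATORIAL CORE of the quotient step, for any finite projective plane and
any collineation `σ ≠ 1` with `σ² = 1` on points, an axis `l` and a centre `c ∈ l`: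

* `moved_of_not_mem_axis` / `fixed_line_iff` — points off `l` are moved; the fixed lines are exactly `l` and the lines through `c`;
* `image_mem_classLine` — `σ x` lies on the line `c x` (the "point class" of `x`);
* `quotient_lambda_two` — for `x, y ∉ l` in DIFFERENT classes (`y ∉ c x`) the lines avoiding `c` that meet both orbits `{x, σx}`
  and `{y, σy}` are exactly four, and `σ` permutes them without fixed points — i.e. exactly TWO block-orbits of the quotient join the two
  point-orbits (`λ = 2`);
* `quotient_lambda_zero` — for `x ≠ y` in the SAME class with `{x,σx} ≠ {y,σy}` there is no such line (`λ = 0` inside a class);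
* `block_meets_class_once` — a line avoiding `c` meets every class line `L ∋ c`, `L ≠ l`, in exactly one point, and that point is off `l`.
These are the STD₂ axioms of the quotient (points = `σ`-orbits off `l` grouped by the lines through `c`; blocks = `σ`-orbits of lines
avoiding `c` grouped by their point on `l`); the bookkeeping "72 + 72 orbits, 12 + 12 classes of 6" for order 12 is immediate from
`fixedCard_eq_13_of_sq` and is not repeated here. The GF(2) lift criterion itself is decided by computation (code/std4/stdlib.py, two
engines + lead third; controls signed by verify-ref 2026-08-20) and is NOT formalised.
-/

namespace Summit.Ventures.DiscreteObjects.PP12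

open Configuration Finset
open scoped Classical

namespace Collineation

variable {P L : Type*} [Membership P L] [ProjectivePlane P L] [Fintype P] [Fintype L]
  [DecidableEq P] [DecidableEq L] (σ : Collineation P L)

section Elation

variable {l : L} {c : P} (hl : σ.IsAxis l) (hc : σ.IsCenter c) (hcl : c ∈ l) (hne : σ.onPoints ≠ 1)
include hl hc hcl hne

omit [DecidableEq P] [DecidableEq L] in
/-- Off the axis every point is moved. -/
theorem moved_of_not_mem_axis {x : P} (hx : x ∉ l) : σ.onPoints x ≠ x := by
  intro fx
  have hxc : x ≠ c := fun h => hx (h ▸ hcl)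
  apply hne
  ext s
  simpa using σ.eq_self_of_central_of_fixed hl hc hx hxc fx s

omit [DecidableEq P] [DecidableEq L] in
/-- The fixed lines of an elation are `l` and the lines through the centre. -/
theorem fixed_line_iff {m : L} : σ.onLines m = m ↔ m = l ∨ c ∈ m := by
  constructor
  · intro fm
    by_contra h
    push Not at h
    -- dual semiregularity: a fixed line off the pencil of c other than l forces σ = 1
    apply hne
    apply σ.onPoints_eq_one_of_onLines
    ext s
    exact σ.dual.eq_self_of_central_of_fixed (l := (c : Dual P)) (c := (l : Dual L)) (r := (m : Dual L))
      hc hl h.2 h.1 fm s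
  · rintro (rfl | hcm)
    · exact σ.axis_fixed hl
    · exact hc m hcm

omit [Fintype P] [Fintype L] [DecidableEq P] [DecidableEq L] hl hcl hne in
/-- `σ x` stays on the class line `c x`. -/
theorem image_mem_classLine {x : P} (hxc : x ≠ c) : σ.onPoints x ∈ (HasLines.mkLine hxc : L) := by
  have h := σ.mem_map (HasLines.mkLine_ax (L := L) hxc).1
  rwa [hc _ (HasLines.mkLine_ax hxc).2] at h

omit [Fintype P] [Fintype L] [DecidableEq P] [DecidableEq L] hl hc hcl hne in
/-- If a line `m` contains two distinct points of the class line `c x`, then `c ∈ m`. (Helper.) -/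
theorem center_mem_of_two {x : P} (hxc : x ≠ c) {m : L} {p q : P} (hp : p ∈ (HasLines.mkLine hxc : L))
    (hq : q ∈ (HasLines.mkLine hxc : L)) (hpq : p ≠ q) (hpm : p ∈ m) (hqm : q ∈ m) : c ∈ m := by
  have : m = HasLines.mkLine hxc := (Nondegenerate.eq_or_eq hpm hqm hp hq).resolve_left hpq
  rw [this]; exact (HasLines.mkLine_ax hxc).2

/-- **λ = 2 across classes.** For `x, y` off the axis with `y` not on the class line of `x`, the lines avoiding `c` that meet both
orbits `{x, σx}` and `{y, σy}` number exactly four, and `σ` permutes them fixed-point-freely (two orbits of size 2). -/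
theorem quotient_lambda_two (hq : σ.onPoints ^ 2 = 1) {x y : P} (hx : x ∉ l) (hy : y ∉ l)
    (hyx : y ∉ (HasLines.mkLine (fun h : x = c => hx (h ▸ hcl)) : L)) :
    (univ.filter fun m : L => c ∉ m ∧ (x ∈ m ∨ σ.onPoints x ∈ m) ∧ (y ∈ m ∨ σ.onPoints y ∈ m)).card = 4 ∧
    ∀ m ∈ univ.filter (fun m : L => c ∉ m ∧ (x ∈ m ∨ σ.onPoints x ∈ m) ∧ (y ∈ m ∨ σ.onPoints y ∈ m)),
      σ.onLines m ≠ m ∧ σ.onLines m ∈ univ.filter (fun m : L => c ∉ m ∧ (x ∈ m ∨ σ.onPoints x ∈ m) ∧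
        (y ∈ m ∨ σ.onPoints y ∈ m)) := by
  have hxc : x ≠ c := fun h => hx (h ▸ hcl)
  have hyc : y ≠ c := fun h => hy (h ▸ hcl)
  set X : L := HasLines.mkLine hxc with hX      -- class line of x
  set Y : L := HasLines.mkLine hyc with hY      -- class line of y
  have hxX : x ∈ X := (HasLines.mkLine_ax hxc).1
  have hcX : c ∈ X := (HasLines.mkLine_ax hxc).2
  have hyY : y ∈ Y := (HasLines.mkLine_ax hyc).1
  have hcY : c ∈ Y := (HasLines.mkLine_ax hyc).2
  set x' := σ.onPoints x with hx'
  set y' := σ.onPoints y with hy'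
  have hx'X : x' ∈ X := σ.image_mem_classLine hc hxc
  have hy'Y : y' ∈ Y := σ.image_mem_classLine hc hyc
  have hx'l : x' ∉ l := σ.map_not_mem_axis hl hx
  have hy'l : y' ∉ l := σ.map_not_mem_axis hl hy
  have hXY : X ≠ Y := fun h => hyx (h ▸ hyY)
  -- points of Y off l are not on X, and vice versa
  have notX : ∀ {q : P}, q ∈ Y → q ∉ l → q ∉ X := by
    intro q hqY hql hqX
    have : q = c := (Nondegenerate.eq_or_eq hqX hcX hqY hcY).resolve_right hXY
    exact hql (this ▸ hcl)
  have notY : ∀ {p : P}, p ∈ X → p ∉ l → p ∉ Y := by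
    intro p hpX hpl hpY
    have : p = c := (Nondegenerate.eq_or_eq hpX hcX hpY hcY).resolve_right hXY
    exact hpl (this ▸ hcl)
  have hyX : y ∉ X := hyx
  have hy'X : y' ∉ X := notX hy'Y hy'l
  have hxY : x ∉ Y := notY hxX hx
  have hx'Y : x' ∉ Y := notY hx'X hx'l
  -- the four joining lines
  have ne : ∀ {p q : P}, p ∈ X → q ∉ X → p ≠ q := fun hp hq h => hq (h ▸ hp)
  let J : P → P → L := fun p q => if h : p ≠ q then HasLines.mkLine h else l
  have Jax : ∀ {p q : P} (h : p ≠ q), p ∈ J p q ∧ q ∈ J p q := by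
    intro p q h; simp only [J, dif_pos h]; exact HasLines.mkLine_ax h
  -- a line containing p ∈ {x,x'} and q ∈ {y,y'} avoids c and equals J p q
  have key : ∀ {p q : P}, p ∈ X → p ∉ l → q ∈ Y → q ∉ l → ∀ {m : L}, p ∈ m → q ∈ m → m = J p q ∧ c ∉ m := by
    intro p q hpX hpl hqY hql m hpm hqm
    have hpq : p ≠ q := ne hpX (notX hqY hql)
    refine ⟨(Nondegenerate.eq_or_eq hpm hqm (Jax hpq).1 (Jax hpq).2).resolve_left hpq, fun hcm => ?_⟩
    have : m = X := (Nondegenerate.eq_or_eq hcm hpm hcX hpX).resolve_left (Ne.symm (fun h => hpl (h ▸ hcl)))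
    exact (notX hqY hql) (this ▸ hqm)
  -- membership characterisation of the filter
  set Q := univ.filter fun m : L => c ∉ m ∧ (x ∈ m ∨ x' ∈ m) ∧ (y ∈ m ∨ y' ∈ m) with hQ
  have memQ : ∀ m : L, m ∈ Q ↔ m = J x y ∨ m = J x y' ∨ m = J x' y ∨ m = J x' y' := by
    intro m
    simp only [hQ, mem_filter, mem_univ, true_and]
    constructor
    · rintro ⟨-, hp | hp, hq' | hq'⟩
      · exact Or.inl (key hxX hx hyY hy hp hq').1
      · exact Or.inr (Or.inl (key hxX hx hy'Y hy'l hp hq').1)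
      · exact Or.inr (Or.inr (Or.inl (key hx'X hx'l hyY hy hp hq').1))
      · exact Or.inr (Or.inr (Or.inr (key hx'X hx'l hy'Y hy'l hp hq').1))
    · have mk : ∀ {p q : P}, p ∈ X → p ∉ l → q ∈ Y → q ∉ l → (p = x ∨ p = x') → (q = y ∨ q = y') →
          c ∉ J p q ∧ (x ∈ J p q ∨ x' ∈ J p q) ∧ (y ∈ J p q ∨ y' ∈ J p q) := by
        intro p q hpX hpl hqY hql hp hq'
        have hpq : p ≠ q := ne hpX (notX hqY hql)
        obtain ⟨h1, h2⟩ := Jax hpq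
        refine ⟨(key hpX hpl hqY hql h1 h2).2, ?_, ?_⟩
        · rcases hp with rfl | rfl
          · exact Or.inl h1
          · exact Or.inr h1
        · rcases hq' with rfl | rfl
          · exact Or.inl h2
          · exact Or.inr h2
      rintro (rfl | rfl | rfl | rfl)
      · exact mk hxX hx hyY hy (Or.inl rfl) (Or.inl rfl)
      · exact mk hxX hx hy'Y hy'l (Or.inl rfl) (Or.inr rfl)
      · exact mk hx'X hx'l hyY hy (Or.inr rfl) (Or.inl rfl)
      · exact mk hx'X hx'l hy'Y hy'l (Or.inr rfl) (Or.inr rfl)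
  -- distinctness: two of the four sharing both of {x,x'} or both of {y,y'} would contain c
  have hxx' : x ≠ x' := (σ.moved_of_not_mem_axis hl hc hcl hne hx).symm
  have hyy' : y ≠ y' := (σ.moved_of_not_mem_axis hl hc hcl hne hy).symm
  have dX : ∀ {q q₂ : P}, q ∈ Y → q ∉ l → q₂ ∈ Y → q₂ ∉ l → J x q ≠ J x' q₂ := by
    intro q q₂ hqY hql hq₂Y hq₂l h
    have h1 := (Jax (ne hxX (notX hqY hql))).1
    have h2 := (Jax (ne hx'X (notX hq₂Y hq₂l))).1
    rw [← h] at h2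
    have hc' := center_mem_of_two hxc hxX hx'X hxx' h1 h2
    exact (key hxX hx hqY hql h1 (Jax (ne hxX (notX hqY hql))).2).2 hc'
  have dY : ∀ {p p₂ : P}, p ∈ X → p ∉ l → p₂ ∈ X → p₂ ∉ l → J p y ≠ J p₂ y' := by
    intro p p₂ hpX hpl hp₂X hp₂l h
    have h1 := (Jax (ne hpX (notX hyY hy))).2
    have h2 := (Jax (ne hp₂X (notX hy'Y hy'l))).2
    rw [← h] at h2
    have hc' := center_mem_of_two hyc hyY hy'Y hyy' h1 h2
    exact (key hpX hpl hyY hy (Jax (ne hpX (notX hyY hy))).1 h1).2 hc'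
  have d12 : J x y ≠ J x y' := dY hxX hx hxX hx
  have d13 : J x y ≠ J x' y := dX hyY hy hyY hy
  have d14 : J x y ≠ J x' y' := dX hyY hy hy'Y hy'l
  have d23 : J x y' ≠ J x' y := dX hy'Y hy'l hyY hy
  have d24 : J x y' ≠ J x' y' := dX hy'Y hy'l hy'Y hy'l
  have d34 : J x' y ≠ J x' y' := dY hx'X hx'l hx'X hx'l
  have hQeq : Q = {J x y, J x y', J x' y, J x' y'} := by
    ext m; rw [memQ]; simp only [Finset.mem_insert, Finset.mem_singleton]
  refine ⟨?_, ?_⟩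
  · rw [hQeq, Finset.card_insert_of_notMem (by simp [d12, d13, d14]),
      Finset.card_insert_of_notMem (by simp [d23, d24]), Finset.card_pair d34]
  · -- σ permutes Q without fixed points
    have sx' : σ.onPoints x' = x := σ.apply_apply_of_sq hq x
    have sy' : σ.onPoints y' = y := σ.apply_apply_of_sq hq y
    have img : ∀ {p q : P}, p ∈ X → p ∉ l → q ∈ Y → q ∉ l → σ.onPoints p ∈ X → σ.onPoints p ∉ l →
        σ.onPoints q ∈ Y → σ.onPoints q ∉ l → σ.onLines (J p q) = J (σ.onPoints p) (σ.onPoints q) := by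
      intro p q hpX hpl hqY hql hspX hspl hsqY hsql
      have hpq : p ≠ q := ne hpX (notX hqY hql)
      have h1 : σ.onPoints p ∈ σ.onLines (J p q) := σ.mem_map (Jax hpq).1
      have h2 : σ.onPoints q ∈ σ.onLines (J p q) := σ.mem_map (Jax hpq).2
      exact (key hspX hspl hsqY hsql h1 h2).1
    intro m hm
    have hm' := (memQ m).1 hm
    have notfixed : σ.onLines m ≠ m := by
      intro fm
      rcases (σ.fixed_line_iff hl hc hcl hne).1 fm with rfl | hcm
      · -- m = l contains x or x', both off l
        have := (Finset.mem_filter.mp hm).2.2.1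
        rcases this with h | h
        · exact hx h
        · exact hx'l h
      · exact (Finset.mem_filter.mp hm).2.1 hcm
    refine ⟨notfixed, ?_⟩
    rw [memQ]
    rcases hm' with rfl | rfl | rfl | rfl
    · right; right; right; rw [img hxX hx hyY hy hx'X hx'l hy'Y hy'l]
    · right; right; left; rw [img hxX hx hy'Y hy'l hx'X hx'l (by rw [sy']; exact hyY) (by rw [sy']; exact hy), sy']
    · right; left; rw [img hx'X hx'l hyY hy (by rw [sx']; exact hxX) (by rw [sx']; exact hx) hy'Y hy'l, sx']
    · left; rw [img hx'X hx'l hy'Y hy'l (by rw [sx']; exact hxX) (by rw [sx']; exact hx) (by rw [sy']; exact hyY)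
        (by rw [sy']; exact hy), sx', sy']

omit [Fintype P] [DecidableEq P] [DecidableEq L] hl hne in
/-- **λ = 0 inside a class.** For `x, y` off the axis on the same class line with distinct orbits, no line avoiding `c` meets both
orbits. -/
theorem quotient_lambda_zero (hq : σ.onPoints ^ 2 = 1) {x y : P} (hx : x ∉ l)
    (hy : y ∈ (HasLines.mkLine (fun h : x = c => hx (h ▸ hcl)) : L)) (hxy : x ≠ y) (hxy' : σ.onPoints x ≠ y) :
    (univ.filter fun m : L => c ∉ m ∧ (x ∈ m ∨ σ.onPoints x ∈ m) ∧ (y ∈ m ∨ σ.onPoints y ∈ m)).card = 0 := by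
  have hxc : x ≠ c := fun h => hx (h ▸ hcl)
  set X : L := HasLines.mkLine hxc
  have hxX : x ∈ X := (HasLines.mkLine_ax hxc).1
  have hcX : c ∈ X := (HasLines.mkLine_ax hxc).2
  have hx'X : σ.onPoints x ∈ X := σ.image_mem_classLine hc hxc
  have hyX : y ∈ X := hy
  have hy'X : σ.onPoints y ∈ X := by
    have h := σ.mem_map hy
    rwa [hc _ hcX] at h
  rw [Finset.card_eq_zero]
  ext m
  simp only [mem_filter, mem_univ, true_and, Finset.notMem_empty, iff_false, not_and]
  intro hcm hp hq'
  -- the two witnesses are distinct points of X, so m = X ∋ c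
  have two : ∀ {p q : P}, p ∈ X → q ∈ X → p ≠ q → p ∈ m → q ∈ m → False := fun hpX hqX hpq hpm hqm =>
    hcm (center_mem_of_two hxc hpX hqX hpq hpm hqm)
  have hxy'' : x ≠ σ.onPoints y := fun h => hxy' (by rw [h]; exact σ.apply_apply_of_sq hq y)
  rcases hp with hp | hp <;> rcases hq' with hq' | hq'
  · exact two hxX hyX hxy hp hq'
  · exact two hxX hy'X hxy'' hp hq'
  · exact two hx'X hyX hxy' hp hq'
  · exact two hx'X hy'X (fun h => hxy (σ.onPoints.injective h)) hp hq'

omit [Fintype P] [Fintype L] [DecidableEq P] [DecidableEq L] hl hc hne in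
/-- **Blocks are transversal to the classes.** A line avoiding `c` meets each class line `L ∋ c`, `L ≠ l`, in exactly one point, and
that point is off the axis. -/
theorem block_meets_class_once {m X : L} (hcm : c ∉ m) (hcX : c ∈ X) (hXl : X ≠ l) :
    ∃ p : P, (p ∈ m ∧ p ∈ X) ∧ p ∉ l ∧ ∀ q : P, q ∈ m → q ∈ X → q = p := by
  have hmX : m ≠ X := fun h => hcm (h ▸ hcX)
  refine ⟨HasPoints.mkPoint hmX, HasPoints.mkPoint_ax hmX, fun hpl => ?_, fun q hqm hqX => ?_⟩
  · -- p ∈ X ∩ l = {c}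
    have : HasPoints.mkPoint hmX = c :=
      (Nondegenerate.eq_or_eq (HasPoints.mkPoint_ax hmX).2 hcX hpl hcl).resolve_right hXl
    exact hcm (this ▸ (HasPoints.mkPoint_ax hmX).1)
  · exact (Nondegenerate.eq_or_eq hqm (HasPoints.mkPoint_ax hmX).1 hqX (HasPoints.mkPoint_ax hmX).2).resolve_right hmX

end Elation

end Collineation

end Summit.Ventures.DiscreteObjects.PP12

namespace Summit.Ventures.DiscreteObjects.PP12

open Configuration Finset
open scoped Classical

namespace Collineation

variable {P L : Type*} [Membership P L] [ProjectivePlane P L] [Fintype P] [Fintype L]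
  [DecidableEq P] [DecidableEq L] (σ : Collineation P L)

/-- **λ = 2 for block classes (the dual STD axiom).** For two lines `m, m'` avoiding the centre `c` and lying in DIFFERENT block
classes (i.e. `m'` does not pass through the point `m ∩ l`), the points off the axis lying on both orbits `{m, σm}` and
`{m', σm'}` number exactly four, permuted by `σ` without fixed points — two point-orbits of the quotient. (This is
`quotient_lambda_two` for the dual collineation: the dual axis is the pencil of `c`, the dual centre is `l`.) -/
theorem quotient_lambda_two_dual {l : L} {c : P} (hl : σ.IsAxis l) (hc : σ.IsCenter c) (hcl : c ∈ l) (hne : σ.onPoints ≠ 1)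
    (hq : σ.onPoints ^ 2 = 1) {m m' : L} (hm : c ∉ m) (hm' : c ∉ m')
    (hmm' : (HasPoints.mkPoint (fun h : m = l => hm (h ▸ hcl)) : P) ∉ m') :
    (univ.filter fun x : P => x ∉ l ∧ (x ∈ m ∨ x ∈ σ.onLines m) ∧ (x ∈ m' ∨ x ∈ σ.onLines m')).card = 4 ∧
    ∀ x ∈ univ.filter (fun x : P => x ∉ l ∧ (x ∈ m ∨ x ∈ σ.onLines m) ∧ (x ∈ m' ∨ x ∈ σ.onLines m')),
      σ.onPoints x ≠ x ∧ σ.onPoints x ∈ univ.filter (fun x : P => x ∉ l ∧ (x ∈ m ∨ x ∈ σ.onLines m) ∧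
        (x ∈ m' ∨ x ∈ σ.onLines m')) := by
  have hneL : σ.dual.onPoints ≠ 1 := fun h => hne (σ.onPoints_eq_one_of_onLines h)
  have hqL : σ.dual.onPoints ^ 2 = 1 := σ.onLines_pow_eq_one hq
  exact σ.dual.quotient_lambda_two (l := (c : Dual P)) (c := (l : Dual L)) hc hl hcl hneL hqL (x := (m : Dual L))
    (y := (m' : Dual L)) hm hm' hmm'

end Collineation

end Summit.Ventures.DiscreteObjects.PP12
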